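import Summits.NavierStokesRegularity.FluidComputer.PalasekTowerGermHost
import Summits.NavierStokesRegularity.FluidComputer.PalasekTowerBoxScheduleAt
import Summits.NavierStokesRegularity.FluidComputer.PalasekTowerRegisterGlobalSmallData

/-!
# The germ host AT ARBITRARY RATES `R`: the strict slot `LevelZeroDataAt R` and HOST PREPARATION for every
# profile filling it (the level-`0` stage of the germ schedule at `R`) — layer L2 of the door port

Cell `ns-blowup`, seat `ns-blowup-ecbridge-3` (g8); GROUP C «BRIDGE SUPPORT» of the route
`PalasekTowerBreakdown` after the RE-BASE (rev 19, 2026-08-27T10:23Z; live crux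
`EpisodeBaseT := EpisodeBaseGAt TowerRates.tuned`, stmt-NavierStokesRegularity-20303). The `R`-generic
twin of `PalasekTowerGermHost.lean` (g3, wide): same profile slot, same line germ
`u(t) = αhost t • (U + σline σ₀ t • V)`, same faded-residual force, the schedule now built by
`Schedule.ofBoxAt R` under the register numerics of `R` bundled as `TowerRates.BoxNumerics R c₃ r`
(discharged here at `wide` and at `tuned`). LABEL: E–C typing (KERNEL construction: a `Prop` structure —
the slot at `R` —, a `Prop` structure — the numerics bundle —, the germ velocity / pressure / force /
schedule at `R` as definitions with body, and their calculus; everything proved). WHAT THIS IS NOT: not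
Navier–Stokes evidence — the host below is a PRESCRIBED flow (its force is its own NS residual, free
before the readout as the register allows); nothing is said about what the Navier–Stokes flow does after
`τ₀`, about any crux, `RungG 1` or blow-up.

## The result

`LevelZeroDataAt R U ρ`: `U` smooth, divergence free, supported in `B̄(0, ρ)`, speed `≤ Y₀(R)` with
equality attained in the ball, strain `≥ A₀(R)` in the ball, an `N₀(R)`-core loop of circulation
`≥ N₀(R)^{β−2}`, and the STRICT FIRST-ORDER ANCHOR TEST `⟪U, P(ΔU − (U·∇)U)⟫ > 0` on the argmax (at
`R = wide` this is `Germ.LevelZeroData`, `levelZeroDataAt_wide_iff`). **`LevelZeroDataAt.stage`**: for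
every such `U`, every register-admissible `R` (`hR : R.BoxNumerics c₃ r`) and every push constant
`c₄ ∈ (0, 1]`, the GERM SCHEDULE `h.schedule hR c₄` — zero datum, force = faded NS residual of the line
germ, rigid window clock of `R`, radius `ρ` — is pinned (`Λ = 8`, `θ = 6/5`), rigid and quiet and carries
a globally anchored registered LEVEL-`0` STAGE (`Margins.routeG R`) whose velocity IS the germ:
`u(τ₀) = U`, `∂ₜu(τ₀) = V`, `f(τ₀) = 0`. So at every register the first child of an `EpisodeBaseGAt R`
design is discharged AT ONCE FOR EVERY PROFILE in the slot; what is left is the episode on `[1, τ₁(R)]`.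
`TowerRates.wide_boxNumerics` (`c₃ = 32`, `r = 1/3`) and `TowerRates.tuned_boxNumerics` (`c₃ = 128`,
`r = 1/3`, `PalasekTowerRegisterWindowTuned`) discharge the numerics at the two registers of record.

References: S. Palasek, arXiv:2605.13827 §3.3–§4 (host preparation before the first readout; Step 2)
[cite: Palasek2026ElementaryModel, §3.3]; A. J. Majda, A. L. Bertozzi, *Vorticity and Incompressible
Flow* (CUP 2002), §1.8 Prop. 1.16 [cite: MajdaBertozziCUP2002, §1.8 Prop. 1.16]; C. L. Fefferman,
Clay problem description, (4)–(7) [cite: FeffermanClay2006, (4) (5) (6) (7)].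
-/

noncomputable section

namespace Summit.NavierStokesRegularity.FluidComputer.PalasekTowerClayBridge

open Set Function Filter Topology InnerProductSpace Metric MeasureTheory
open scoped Topology ContDiff RealInnerProductSpace ENNReal Laplacian

open Literature.Analysis.FluidPDE

/-! ## §0 The register numerics of a rates record, bundled -/

/-- **The register numerics of a rates record `R`** used by the box schedule at `R`: geometric domination
of the rigid windows with ratio `r ∈ [0, 1)`, the clock witness `c₃` (`A_k w_{k+1} ≤ (1 − r) c₃`), the
registered band `2Y_k ≤ Y_{k+1}` and small windows `24 w_k ≤ 1`. [cite: Palasek2026ElementaryModel, §3.3] -/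
structure TowerRates.BoxNumerics (R : TowerRates) (c₃ r : ℝ) : Prop where
  /-- `0 ≤ r` -/
  r_nonneg : 0 ≤ r
  /-- `r < 1` -/
  r_lt_one : r < 1
  /-- geometric domination of the windows -/
  geo : ∀ k, R.window (k + 1) ≤ r * R.window k
  /-- the clock witness covers the tails -/
  clock : ∀ k, R.A k * R.window (k + 1) ≤ (1 - r) * c₃
  /-- the registered band -/
  sep : ∀ k, 2 * R.Y k ≤ R.Y (k + 1)
  /-- small windows (the push never competes with the jump) -/
  window_le : ∀ k, 24 * R.window k ≤ 1

/-- On the wide base `24 w_k ≤ 1` (`Y_k w_k ≤ 1/4`, `Y_k ≥ 256`). [folklore] -/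
theorem TowerRates.wide_window_le (k : ℕ) : 24 * TowerRates.wide.window k ≤ 1 := by
  have h1 := TowerRates.wide_Y_mul_window_le k
  have h2 := TowerRates.wide_Y_ge k
  have hw : 0 < TowerRates.wide.window k := TowerRates.wide.window_pos k
  nlinarith

/-- **The wide base is register-admissible** (`c₃ = 32`, `r = 1/3`). [folklore] -/
theorem TowerRates.wide_boxNumerics : TowerRates.wide.BoxNumerics 32 (1 / 3) where
  r_nonneg := by norm_num
  r_lt_one := by norm_num
  geo := TowerRates.wide_window_geo
  clock := TowerRates.wide_window_clock
  sep := TowerRates.wide_sep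
  window_le := TowerRates.wide_window_le

/-- **The tuned rates are register-admissible** (`c₃ = 128`, `r = 1/3`). [folklore] -/
theorem TowerRates.tuned_boxNumerics : TowerRates.tuned.BoxNumerics 128 (1 / 3) where
  r_nonneg := by norm_num
  r_lt_one := by norm_num
  geo := TowerRates.tuned_window_geo
  clock := TowerRates.tuned_window_clock
  sep := TowerRates.tuned_sep
  window_le := TowerRates.tuned_window_le

namespace Germ

variable {R : TowerRates}

/-! ## §1 The design slot at the rates `R` -/

/-- **LEVEL-`0` DATA OF A NAMED PROFILE** (the design slot of the germ host AT THE RATES `R`, unit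
viscosity, register v2.3′): smooth, divergence free, supported in `B̄(0, ρ)`; speed `≤ Y₀` everywhere and
`= Y₀` somewhere in the ball; strain `≥ A₀` somewhere in the ball; an `N₀`-core loop in the ball with
circulation `≥ N₀^{β−2}` (`CoreLedger` at level `0`, `c₁ = 1`); and the STRICT FIRST-ORDER ANCHOR TEST
`⟪U, P(ΔU − (U·∇)U)⟫ > 0` on the argmax of `‖U‖`. [cite: Palasek2026ElementaryModel, §3.3] -/
structure LevelZeroDataAt (R : TowerRates) (U : EuclideanSpace ℝ (Fin 3) → EuclideanSpace ℝ (Fin 3)) (ρ : ℝ) : Prop where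
  /-- the profile is smooth -/
  smooth : ContDiff ℝ ∞ U
  /-- … supported in the closed ball of radius `ρ` -/
  support : tsupport U ⊆ closedBall 0 ρ
  /-- … and divergence free -/
  divFree : VectorCalculus.IsDivFree U
  /-- speed ceiling `Y₀` everywhere (the anchor's value at the readout) -/
  ceiling : ∀ x, ‖U x‖ ≤ R.Y 0
  /-- speed floor `Y₀` attained in the ball -/
  floor : ∃ x, ‖x‖ ≤ ρ ∧ R.Y 0 ≤ ‖U x‖
  /-- strain floor `A₀` attained in the ball -/
  strain : ∃ x, ‖x‖ ≤ ρ ∧ R.A 0 ≤ ‖fderiv ℝ U x‖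
  /-- the level-`0` core loop: inside a `1/N₀`-ball centred in the ball, speed `≤ 8π/N₀`,
  circulation `≥ N₀^{β−2}` -/
  core : ∃ (x : EuclideanSpace ℝ (Fin 3)) (γ : ℝ → EuclideanSpace ℝ (Fin 3)),
    ‖x‖ ≤ ρ ∧ ContDiff ℝ 1 γ ∧ γ 0 = γ 1 ∧
      (∀ s ∈ Icc (0 : ℝ) 1, γ s ∈ closedBall x (1 / R.N 0)) ∧
      (∀ s ∈ Icc (0 : ℝ) 1, ‖deriv γ s‖ ≤ 8 * Real.pi / R.N 0) ∧
      R.N 0 ^ (R.β - 2) ≤ circulation U γ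
  /-- the strict first-order anchor test at the speed maximum -/
  anchor : ∀ x, ‖U x‖ = R.Y 0 → 0 < ⟪U x, accel 1 U x⟫

namespace LevelZeroDataAt

variable {U : EuclideanSpace ℝ (Fin 3) → EuclideanSpace ℝ (Fin 3)} {ρ : ℝ} (h : LevelZeroDataAt R U ρ)
include h

/-- The profile is confined to `B̄(0, ρ)` and has compact support. [folklore] -/
theorem confined : (tsupport U ⊆ closedBall 0 ρ) ∧ HasCompactSupport U :=
  ⟨h.support, (isCompact_closedBall (0 : EuclideanSpace ℝ (Fin 3)) ρ).of_isClosed_subset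
    (isClosed_tsupport U) h.support⟩

/-! ## §2 The width of the anchored segment and the fade length (choices) -/

/-- The anchored segment exists (strict test ⇒ line anchor, `exists_line_anchor`). [folklore] -/
theorem exists_width : ∃ σ₀ : ℝ, 0 < σ₀ ∧
    ∀ σ : ℝ, -σ₀ < σ → σ < 0 → ∀ x, ‖U x + σ • accel 1 U x‖ < R.Y 0 :=
  exists_line_anchor h.smooth h.confined.2 (R.Y_pos 0) h.ceiling h.anchor

/-- **The width `σ₀` of the anchored segment** (a choice). [folklore] -/
def width : ℝ := h.exists_width.choose

/-- `0 < σ₀` and the line anchor at width `σ₀`. [folklore] -/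
theorem width_spec : 0 < h.width ∧ ∀ σ : ℝ, -h.width < σ → σ < 0 →
    ∀ x, ‖U x + σ • accel 1 U x‖ < R.Y 0 :=
  h.exists_width.choose_spec

/-- The fade length exists: after the matched instant `τ₀ = 1` the residual of the line germ stays
`≤ c₄ Y₀` for a while (`exists_window_norm_germResid_le`), and we may take that while `≤ w₀`.
[folklore] -/
theorem exists_fadeLen {c₄ : ℝ} (hc₄ : 0 < c₄) : ∃ ε : ℝ, 0 < ε ∧ ε ≤ Host.wfirstAt R ∧
    ∀ t ∈ Icc (1 : ℝ) (1 + ε), ∀ x : EuclideanSpace ℝ (Fin 3),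
      ‖germResid 1 U αhost (βhost h.width) t x‖ ≤ c₄ * R.Y 0 := by
  have hδ : 0 < c₄ * R.Y 0 := mul_pos hc₄ (R.Y_pos 0)
  obtain ⟨ε, hε, hwin⟩ := exists_window_norm_germResid_le (ν := 1) h.smooth h.confined.2
    contDiff_αhost (contDiff_βhost h.width) αhost_one deriv_αhost_one (βhost_one h.width)
    (deriv_βhost_one h.width_spec.1.ne') h.support hδ
  refine ⟨min ε (Host.wfirstAt R), lt_min hε (Host.wfirstAt_pos R), min_le_right _ _, fun t ht x => ?_⟩
  exact hwin t ⟨ht.1, ht.2.trans (by linarith [min_le_left ε (Host.wfirstAt R)])⟩ x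

/-- **The fade length `ε`** for the push constant `c₄` (a choice). [folklore] -/
def fadeLen {c₄ : ℝ} (hc₄ : 0 < c₄) : ℝ := (h.exists_fadeLen hc₄).choose

/-- `0 < ε ≤ w₀(R)` and the residual is `≤ c₄ Y₀(R)` on `[1, 1 + ε] × ℝ³`. [folklore] -/
theorem fadeLen_spec {c₄ : ℝ} (hc₄ : 0 < c₄) :
    0 < h.fadeLen hc₄ ∧ h.fadeLen hc₄ ≤ Host.wfirstAt R ∧
      ∀ t ∈ Icc (1 : ℝ) (1 + h.fadeLen hc₄), ∀ x : EuclideanSpace ℝ (Fin 3),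
        ‖germResid 1 U αhost (βhost h.width) t x‖ ≤ c₄ * R.Y 0 :=
  (h.exists_fadeLen hc₄).choose_spec

/-! ## §3 The velocity, pressure and force of the germ host -/

/-- **The velocity of the germ host**: the line germ `αhost t • (U + σline σ₀ t • V)`. [folklore] -/
def vel : ℝ → EuclideanSpace ℝ (Fin 3) → EuclideanSpace ℝ (Fin 3) := germ 1 U αhost (βhost h.width)

/-- **The pressure of the germ host**: `β' π − β² |∇π|²/2`. [folklore] -/
def pres : ℝ → EuclideanSpace ℝ (Fin 3) → ℝ := germPres 1 U (βhost h.width)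

/-- **The force of the germ host** for push constant `c₄`: the NS residual of the germ, faded out on
`[1, 1 + ε]`. [folklore] -/
def force {c₄ : ℝ} (hc₄ : 0 < c₄) : ℝ → EuclideanSpace ℝ (Fin 3) → EuclideanSpace ℝ (Fin 3) :=
  germForce 1 U αhost (βhost h.width) (1 + h.fadeLen hc₄) (h.fadeLen hc₄)

/-- **The force's static facts**: jointly smooth, compact space-time support (box `[0, 1 + ε] × B̄(0, ρ)`),
confined to the ball, equal to the residual of the germ on the host's slab `t ≤ 1`, and ZERO AT THE READOUT
`τ₀ = 1` (the germ is matched). [cite: FeffermanClay2006, (5) (6)] -/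
theorem force_spec {c₄ : ℝ} (hc₄ : 0 < c₄) :
    ContDiff ℝ ∞ (uncurry (h.force hc₄)) ∧ HasCompactSupport (uncurry (h.force hc₄)) ∧
      (∀ t (x : EuclideanSpace ℝ (Fin 3)), ρ < ‖x‖ → h.force hc₄ t x = 0) ∧
      (∀ t, t ≤ 1 → ∀ x : EuclideanSpace ℝ (Fin 3),
        h.force hc₄ t x = germResid 1 U αhost (βhost h.width) t x) ∧
      ∀ x : EuclideanSpace ℝ (Fin 3), h.force hc₄ 1 x = 0 := by
  have hres : ∀ t, t ≤ 1 → ∀ x : EuclideanSpace ℝ (Fin 3),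
      h.force hc₄ t x = germResid 1 U αhost (βhost h.width) t x := fun t ht x =>
    germForce_eq_germResid (h.fadeLen_spec hc₄).1 (by linarith) x
  refine ⟨contDiff_uncurry_germForce h.smooth h.confined.2 contDiff_αhost (contDiff_βhost _),
    hasCompactSupport_germForce h.smooth h.confined.2 (h.fadeLen_spec hc₄).1 h.support
      (fun _ ht => αhost_of_nonpos ht) (fun _ ht => βhost_of_nonpos ht),
    fun t x hx => germForce_eq_zero_of_norm_gt h.smooth h.confined.2 h.support t hx, hres,
    fun x => ?_⟩
  rw [hres 1 le_rfl]
  exact germResid_eq_zero_of_matched αhost_one deriv_αhost_one (βhost_one _)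
    (deriv_βhost_one h.width_spec.1.ne') x

/-- The force vanishes from `τ₁ = 1 + w₀` on (indeed from `1 + ε` on). [folklore] -/
theorem force_eq_zero_of_ge {c₄ : ℝ} (hc₄ : 0 < c₄) :
    ∀ t, Host.τfirstAt R ≤ t → ∀ x, h.force hc₄ t x = 0 := by
  intro t ht x
  have h1 : 1 + h.fadeLen hc₄ ≤ t := by
    rw [Host.τfirstAt_eq R] at ht
    linarith [(h.fadeLen_spec hc₄).2.1]
  exact germForce_eq_zero_of_ge ((h.fadeLen_spec hc₄).1) h1 x

/-- The window bound: `‖force‖ ≤ c₄ Y₀` on `[1, τ₁]` (indeed at every `t ≥ 1`). [folklore] -/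
theorem norm_force_le {c₄ : ℝ} (hc₄ : 0 < c₄) :
    ∀ t ∈ Icc (1 : ℝ) (Host.τfirstAt R), ∀ x, ‖h.force hc₄ t x‖ ≤ c₄ * R.Y 0 :=
  fun _ ht x => norm_germForce_le_of_window ((h.fadeLen_spec hc₄).1)
    (mul_pos hc₄ (R.Y_pos 0)).le ((h.fadeLen_spec hc₄).2.2) ht.1 x

/-! ## §4 The germ schedule -/

/-- **THE GERM SCHEDULE OF THE NAMED PROFILE AT THE RATES `R`** for push constant `c₄ ∈ (0, 1]`: the box
schedule at `R` (`Schedule.ofBoxAt`, register numerics `hR`) with zero datum, the faded germ force, radius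
`ρ`. [cite: Palasek2026ElementaryModel, §3.3] -/
def schedule {c₃ r : ℝ} (hR : R.BoxNumerics c₃ r) (c₄ : ℝ) (hc₄ : 0 < c₄) (hc₄' : c₄ ≤ 1) : Schedule R :=
  Schedule.ofBoxAt R c₃ r hR.r_nonneg hR.r_lt_one hR.geo hR.clock (hR.sep 0) 0 (h.force hc₄) ρ c₄ hc₄'
    contDiff_const HasCompactSupport.zero (h.force_spec hc₄).1 (h.force_spec hc₄).2.1
    (h.force_eq_zero_of_ge hc₄) (h.norm_force_le hc₄)

section Schedule

variable {c₃ r : ℝ} (hR : R.BoxNumerics c₃ r) {c₄ : ℝ} (hc₄ : 0 < c₄) (hc₄' : c₄ ≤ 1)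

/-- The germ schedule is RIGID. [folklore] -/
theorem schedule_rigid : (h.schedule hR c₄ hc₄ hc₄').Rigid :=
  Schedule.ofBoxAt_rigid _ _ _ _ _ _ _ _ _ _ _ _

/-- The germ schedule is QUIET. [folklore] -/
theorem schedule_quiet : (h.schedule hR c₄ hc₄ hc₄').Quiet :=
  Schedule.ofBoxAt_quiet _ _ _ _ _ _ _ _ _ _ _ _

/-- The germ schedule is PINNED (`Λ = 8`, `θ = 6/5`). [folklore] -/
theorem schedule_pins : (h.schedule hR c₄ hc₄ hc₄').Pins 8 (6 / 5) :=
  Schedule.ofBoxAt_pins _ _ _ _ _ _ _ _ _ _ _ _ hR.sep hR.window_le (fun _ _ => rfl)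
    (h.force_spec hc₄).2.2.1

/-- `τ 0 = 1`. [folklore] -/
theorem schedule_τ_zero : (h.schedule hR c₄ hc₄ hc₄').τ 0 = 1 := Host.windowTimeAt_zero R

/-- The force of the germ schedule. [folklore] -/
theorem schedule_f : (h.schedule hR c₄ hc₄ hc₄').f = h.force hc₄ := rfl

/-- The radius of the germ schedule is `ρ`. [folklore] -/
theorem schedule_radius : (h.schedule hR c₄ hc₄ hc₄').radius = ρ := rfl

/-- `c₁ = 1`. [folklore] -/
theorem schedule_c₁ : (h.schedule hR c₄ hc₄ hc₄').c₁ = 1 := rfl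

/-- `c₂ = 5/3`. [folklore] -/
theorem schedule_c₂ : (h.schedule hR c₄ hc₄ hc₄').c₂ = 5 / 3 := rfl

/-! ## §5 The level-`0` stage: the germ -/

/-- **The germ solves forced Navier–Stokes with the schedule's force on the host's slab `[0, 1]`.**
[cite: FeffermanClay2006, (1) (2)] -/
theorem isClassicalNSSolutionOn_vel :
    IsClassicalNSSolutionOn (Icc 0 1) 1 (h.schedule hR c₄ hc₄ hc₄').f h.vel h.pres := by
  have hb := isClassicalNSSolutionOn_germ (ν := 1) (α := αhost) (β := βhost h.width) h.smooth
    h.confined.2 contDiff_αhost (contDiff_βhost _) h.divFree one_pos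
  refine ⟨hb.smooth_velocity, hb.smooth_pressure, fun t ht x => ?_, hb.divFree⟩
  have hf : (h.schedule hR c₄ hc₄ hc₄').f t x = germResid 1 U αhost (βhost h.width) t x :=
    (h.force_spec hc₄).2.2.2.1 t ht.2 x
  rw [hf]
  exact hb.momentum t ht x

/-- **The germ host's readout facts**: it starts from rest, arrives at the named profile at the readout
`τ₀ = 1` with the NS acceleration of the profile (`u(0) = 0`, `u(1) = U`, `∂ₜu(1) = V`), and has finite
energy on the slab. [cite: FeffermanClay2006, (7)] -/
theorem vel_spec : h.vel 0 = 0 ∧ h.vel 1 = U ∧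
    (∀ x : EuclideanSpace ℝ (Fin 3), timeDerivWithin (Icc 0 1) h.vel 1 x = accel 1 U x) ∧
      ∃ C : ℝ≥0∞, C < ⊤ ∧ ∀ t ∈ Icc (0 : ℝ) 1, ∫⁻ x, ‖h.vel t x‖ₑ ^ 2 ≤ C := by
  refine ⟨germ_line_zero 1 U h.width, germ_line_one 1 U h.width, fun x => ?_,
    energy_germ (ν := 1) h.smooth h.confined.2 (fun t _ => abs_αhost_le_one t)
      (fun _ ht => abs_βhost_le h.width_spec.1 ht.2)⟩
  rw [vel, timeDerivWithin_germ (contDiff_αhost.differentiable (by simp))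
    ((contDiff_βhost _).differentiable (by simp)) one_pos ⟨zero_le_one, le_rfl⟩,
    deriv_αhost_one, deriv_βhost_one h.width_spec.1.ne', zero_smul, one_smul, zero_add]

/-- **THE GLOBAL ANCHOR**: `‖u(t, x)‖ < Y₀` for all `t < 1` and all `x`. [folklore] -/
theorem norm_vel_lt {t : ℝ} (ht : t < 1) (x : EuclideanSpace ℝ (Fin 3)) :
    ‖h.vel t x‖ < R.Y 0 :=
  norm_germ_lt h.width_spec.1 h.width_spec.2 ht x

/-- The ceiling on the slab: `‖u(t, x)‖ ≤ Y₀` for `t ≤ 1`. [folklore] -/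
theorem norm_vel_le {t : ℝ} (ht : t ≤ 1) (x : EuclideanSpace ℝ (Fin 3)) :
    ‖h.vel t x‖ ≤ R.Y 0 :=
  norm_germ_le h.width_spec.1 h.ceiling h.width_spec.2 ht x

/-- **THE LEVEL-`0` STAGE OF THE GERM SCHEDULE**: exact classical forced Navier–Stokes on `[0, 1]`,
zero datum, finite energy, the level-`0` floor / ceiling, and the route margin `routeG` — strain floor,
the GLOBAL ANCHOR, rigidity, the core ledger — all read off the named profile `U = u(τ₀)`.
[cite: Palasek2026ElementaryModel, §3.3] -/
theorem stage : Nonempty (Stage 1 R (h.schedule hR c₄ hc₄ hc₄')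
    (Margins.routeG R) 0) := by
  have hτ0 : (h.schedule hR c₄ hc₄ hc₄').τ 0 = 1 := h.schedule_τ_zero hR hc₄ hc₄'
  have hY := (R.Y_pos 0)
  have henergy : ∃ C : ℝ≥0∞, C < ⊤ ∧ ∀ t ∈ Icc 0 ((h.schedule hR c₄ hc₄ hc₄').τ 0),
      ∫⁻ x, ‖h.vel t x‖ₑ ^ 2 ≤ C := by
    rw [hτ0]; exact h.vel_spec.2.2.2
  have hcl : IsClassicalNSSolutionOn (Icc 0 ((h.schedule hR c₄ hc₄ hc₄').τ 0)) 1
      (h.schedule hR c₄ hc₄ hc₄').f h.vel h.pres := by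
    rw [hτ0]; exact h.isClassicalNSSolutionOn_vel hR hc₄ hc₄'
  refine ⟨{ u := h.vel, p := h.pres, classical := hcl, initial := ?_, energy := henergy,
            floor := ?_, ceiling := ?_, quiet := ?_, margin := ?_ }⟩
  · rw [h.vel_spec.1]; rfl
  · intro j hj
    obtain rfl := Nat.le_zero.1 hj
    obtain ⟨x, hx, hfl⟩ := h.floor
    refine ⟨x, hx, ?_⟩
    rw [hτ0, schedule_c₁, one_mul, h.vel_spec.2.1]
    exact hfl
  · intro j hj t ht x
    obtain rfl := Nat.le_zero.1 hj
    rw [hτ0] at ht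
    rw [schedule_c₂]
    have := h.norm_vel_le ht.2 x
    linarith
  · intro j hj
    exact absurd hj (by omega)
  · show (∀ j, j ≤ 0 → ∃ x, ‖x‖ ≤ (h.schedule hR c₄ hc₄ hc₄').radius ∧
        (h.schedule hR c₄ hc₄ hc₄').c₁ * R.A j ≤
          ‖fderiv ℝ (h.vel ((h.schedule hR c₄ hc₄ hc₄').τ j)) x‖) ∧
      ((h.schedule hR c₄ hc₄ hc₄').AnchorGlobal h.vel ∧
        ((h.schedule hR c₄ hc₄ hc₄').Rigid ∧
          CoreLedger R (h.schedule hR c₄ hc₄ hc₄') 0 h.vel))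
    refine ⟨?_, ?_, h.schedule_rigid hR hc₄ hc₄', ?_⟩
    · intro j hj
      obtain rfl := Nat.le_zero.1 hj
      obtain ⟨x, hx, hst⟩ := h.strain
      refine ⟨x, hx, ?_⟩
      rw [hτ0, schedule_c₁, one_mul, h.vel_spec.2.1]
      exact hst
    · intro t ht x
      rw [hτ0] at ht
      rw [schedule_c₁, one_mul]
      exact h.norm_vel_lt ht.2 x
    · intro j hj
      obtain rfl := Nat.le_zero.1 hj
      obtain ⟨x, γ, hx, hγ, hcl', hball, hspeed, hcirc⟩ := h.core
      refine ⟨x, γ, hx, hγ, hcl', hball, hspeed, ?_⟩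
      rw [hτ0, schedule_c₁, one_mul, h.vel_spec.2.1]
      exact hcirc

end Schedule

end LevelZeroDataAt

/-! ## §6 At `R = wide` the slot is the slot of record -/

/-- `LevelZeroDataAt wide U ρ ↔ LevelZeroData U ρ`. [folklore] -/
theorem levelZeroDataAt_wide_iff {U : EuclideanSpace ℝ (Fin 3) → EuclideanSpace ℝ (Fin 3)} {ρ : ℝ} :
    LevelZeroDataAt TowerRates.wide U ρ ↔ LevelZeroData U ρ :=
  ⟨fun h => ⟨h.smooth, h.support, h.divFree, h.ceiling, h.floor, h.strain, h.core, h.anchor⟩,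
    fun h => ⟨h.smooth, h.support, h.divFree, h.ceiling, h.floor, h.strain, h.core, h.anchor⟩⟩

end Germ

end Summit.NavierStokesRegularity.FluidComputer.PalasekTowerClayBridge

end
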